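import Mathlib.ModelTheory.Basic
import Mathlib.ModelTheory.Syntax
import Mathlib.ModelTheory.Semantics
import Mathlib.ModelTheory.Complexity
import Mathlib.Algebra.BigOperators.Fin
import Mathlib.Computability.Encoding
import Literature.Computability.Complexity.BoolEncodings
import Literature.Computability.Complexity.Nondeterministic
import Literature.Computability.Cryptography.Subexponential
import HarnessLib

-- provenance: harness21/H21/H21/Prelude/CryptoQuantFine/SNP.lean @ 18f4f3b (interim HEAD d8f2665); M5 mechanical rewrite
/-!
# Crypto/Quantum/Fine-grained prelude: the logical class SNP

Trunk `CryptoQuantFine`, outline item F8 (realises the notion `class_SNP_logical`).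

*Strict NP* (`SNP`, Papadimitriou–Yannakakis) is the syntactic fragment of Fagin's existential
second-order logic consisting of the properties of finite relational structures expressible as
`∃ S₁ … S_m ∀ x₁ … x_k φ(x̄; R̄, S̄)` with `φ` quantifier-free: a second-order existential
block over *witness* relations `S̄`, followed by a *universal* first-order sentence over the joint
vocabulary of the *input* relations `R̄` and the witnesses. Impagliazzo–Paturi–Zane view each SNP
property as a *parameterised problem* whose complexity parameter is the number of bits needed to
write down the witness relations on a universe of size `n`, namely `∑ᵢ n^{arity Sᵢ}`; with this
parameter `k`-SAT (`k ≥ 3`) is SNP-complete under SERF reductions.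

We build on Mathlib's first-order model theory: a purely relational vocabulary is given by its
list of arities (`relLanguage`), the joint vocabulary is `FirstOrder.Language.sum`, joint
structures are `FirstOrder.Language.sumStructure`, sentences and satisfaction are
`FirstOrder.Language.Sentence` and `Sentence.Realize`, and universality of the first-order part
is `FirstOrder.Language.BoundedFormula.IsUniversal` (all existing Mathlib notions, reused, not
redefined). Finite structures on `Fin n` are tabulated as Boolean tables (`RelTables`) and encoded
over `Bool` with the accepted H21 combinators `Encoding.sigmaBool`, `encodingBitVec` and the
Mathlib equivalences `finFunctionFinEquiv`, `finSigmaFinEquiv` (a real `decode_encode` proof, no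
`sorry` in the encoding). `SNPFormula.toParamProblem` then goes through the accepted
`ParamProblem.ofEncoding` (F7), so its parameter is well defined on codewords and `0` off-code.

Contents: `relLanguage`, `RelTables`, `structureOfTables`, `tablesOfStructure`, `SNPFormula`,
`SNPFormula.Holds`, `SNPFormula.HoldsOnTables`, `SNPInstance`, `tableBits`, `relTablesEquiv`,
`encodingRelTables`, `encodingSNPInstance`, `SNPFormula.language`, `SNPFormula.witnessBits`,
`SNPFormula.toParamProblem`, `SNP`, `SNPLanguages`; API `holdsOnTables_iff`,
`SNPLanguages_subset_NP` (Fagin's easy direction, `sorry`), `witnessBits_mono`.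

## Design notes

* Both `FirstOrder.Language` (model theory) and `Language Bool` (computability) occur in this
  file. We never `open FirstOrder` at top level; model-theoretic names are fully qualified or
  opened per declaration with `open … in`.
* `relLanguage ar` has relation symbols `{i : Fin ar.length // ar.get i = k}` in arity `k` and no
  function symbols; we register `IsRelational` for it (an instance on our own language, not on a
  Mathlib one).
* `SNPFormula.Holds Φ M` quantifies over *all* `(relLanguage Φ.witnessArities)`-structures on
  `M`; since the witness language is relational, on `Fin n` these are exactly the Boolean tables
  (`holdsOnTables_iff`).
* MaxSNP (Papadimitriou–Yannakakis §3), also named by the notion `class_SNP_logical`, is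
  deliberately omitted: no target statement of H21 uses it.
* Mathlib has no SNP / ESO fragment / Fagin's theorem (searched `SNP`, `Fagin`, `secondOrder`,
  `ESO`); nothing here duplicates Mathlib.

## References

* C. H. Papadimitriou, M. Yannakakis, *Optimization, approximation, and complexity classes*,
  J. Comput. System Sci. 43 (1991) 425–440, §2 (SNP).
* R. Fagin, *Generalized first-order spectra and polynomial-time recognizable sets*,
  SIAM–AMS Proc. 7 (1974) 43–73 (∃SO = NP).
* R. Impagliazzo, R. Paturi, F. Zane, *Which problems have strongly exponential complexity?*,
  J. Comput. System Sci. 63 (2001) 512–530, §3 (SNP with size parameter, SNP ⊆ SE question).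
* H21 outline `CryptoQuantFine`, F8.
-/

namespace Literature.Computability.Cryptography

open _root_.Computability Complexity Complexity.Nondeterministic

/-! ### Relational vocabularies and finite structures as tables -/

/-- The purely relational first-order vocabulary with arity list `ar`: one relation symbol
`⟨i, _⟩` of arity `ar.get i` for each position `i` of the list, and no function symbols.
[Papadimitriou–Yannakakis 1991, §2; Fagin 1974] [cite: PapadimitriouYannakakis1991, §2] -/
def relLanguage (ar : List ℕ) : FirstOrder.Language :=
  ⟨fun _ => Empty, fun k => {i : Fin ar.length // ar.get i = k}⟩

/-- `relLanguage ar` has no function symbols. (Instance on an H21-defined language.)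
[Papadimitriou–Yannakakis 1991, §2] [cite: PapadimitriouYannakakis1991, §2] -/
instance relLanguage.isRelational (ar : List ℕ) : (relLanguage ar).IsRelational :=
  fun _ => inferInstanceAs (IsEmpty Empty)

/-- Boolean tables for the relations of `relLanguage ar` on the universe `Fin n`: for each
symbol `i`, a truth table `(Fin (ar.get i) → Fin n) → Bool`. This is the concrete input format of
an SNP problem. [Impagliazzo–Paturi–Zane 2001, §3] [cite: ImpagliazzoPaturiZane2001, §3] -/
abbrev RelTables (ar : List ℕ) (n : ℕ) : Type :=
  ∀ i : Fin ar.length, (Fin (ar.get i) → Fin n) → Bool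

/-- The `(relLanguage ar)`-structure on `Fin n` determined by Boolean tables `R`: the relation
symbol `⟨i, h⟩` (of arity `k = ar.get i`) holds of a tuple `v : Fin k → Fin n` iff
`R i (v ∘ Fin.cast h) = true`. [Fagin 1974; Impagliazzo–Paturi–Zane 2001, §3] [cite: Fagin1974] -/
@[reducible] def structureOfTables {ar : List ℕ} {n : ℕ} (R : RelTables ar n) :
    (relLanguage ar).Structure (Fin n) where
  RelMap := fun r v => R r.1 (v ∘ Fin.cast r.2) = true

/-- The Boolean tables of a `(relLanguage ar)`-structure on `Fin n` (inverse to
`structureOfTables`; noncomputable: uses classical decidability of `RelMap`).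
[Fagin 1974; Impagliazzo–Paturi–Zane 2001, §3] [cite: Fagin1974] -/
noncomputable def tablesOfStructure {ar : List ℕ} {n : ℕ}
    (S : (relLanguage ar).Structure (Fin n)) : RelTables ar n :=
  fun i v => by
    classical
    exact decide (S.RelMap (⟨i, rfl⟩ : (relLanguage ar).Relations (ar.get i)) v)

/-- `tablesOfStructure` is a left inverse of `structureOfTables`. [Fagin 1974] [cite: Fagin1974] -/
@[simp] theorem tablesOfStructure_structureOfTables {ar : List ℕ} {n : ℕ} (R : RelTables ar n) :
    tablesOfStructure (structureOfTables R) = R := by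
  funext i v
  simp [tablesOfStructure, FirstOrder.Language.Structure.RelMap]

/-- `structureOfTables` is a left inverse of `tablesOfStructure`: every structure for a
relational vocabulary on `Fin n` is given by its tables. [Fagin 1974] [cite: Fagin1974] -/
@[simp] theorem structureOfTables_tablesOfStructure {ar : List ℕ} {n : ℕ}
    (S : (relLanguage ar).Structure (Fin n)) :
    structureOfTables (tablesOfStructure S) = S := by
  refine FirstOrder.Language.Structure.ext ?_ ?_
  · funext k f
    exact f.elim
  · funext k r v
    obtain ⟨i, rfl⟩ := r
    simp [tablesOfStructure, FirstOrder.Language.Structure.RelMap]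

/-! ### SNP formulas and their semantics -/

/-- An *SNP formula* `∃ S̄ ∀ x̄ φ`: a list of arities of the input relations `R̄`, a list of
arities of the existentially quantified witness relations `S̄`, and a *universal* first-order
sentence over the joint vocabulary `R̄ ⊔ S̄` (`FirstOrder.Language.sum`), universality being
Mathlib's `BoundedFormula.IsUniversal` (a block of `∀` over a quantifier-free matrix).
[Papadimitriou–Yannakakis 1991, §2; Kolaitis–Vardi 1987] [cite: PapadimitriouYannakakis1991, §2] -/
structure SNPFormula where
  /-- Arities of the input relation symbols `R₁, …, R_l`. -/
  inputArities : List ℕ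
  /-- Arities of the second-order existentially quantified relation symbols `S₁, …, S_m`. -/
  witnessArities : List ℕ
  /-- The first-order part, a sentence over inputs and witnesses. -/
  sentence : ((relLanguage inputArities).sum (relLanguage witnessArities)).Sentence
  /-- The first-order part is universal (`∀ x̄ φ`, `φ` quantifier-free). -/
  isUniversal : sentence.IsUniversal

namespace SNPFormula

/-- Semantics of an SNP formula on an input structure `M` (interpreting the input relations):
`Φ` holds iff there EXISTS an interpretation `S` of the witness relations on `M` such that the
joint structure (`FirstOrder.Language.sumStructure`) satisfies the universal sentence.
[Papadimitriou–Yannakakis 1991, §2; Fagin 1974] [cite: PapadimitriouYannakakis1991, §2] -/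
def Holds (Φ : SNPFormula) (M : Type) [(relLanguage Φ.inputArities).Structure M] : Prop :=
  ∃ S : (relLanguage Φ.witnessArities).Structure M,
    @FirstOrder.Language.Sentence.Realize _ M
      (@FirstOrder.Language.sumStructure _ _ M _ S) Φ.sentence

/-- Semantics of an SNP formula on a finite input given by Boolean tables `R` on `Fin n`.
[Impagliazzo–Paturi–Zane 2001, §3] [cite: ImpagliazzoPaturiZane2001, §3] -/
def HoldsOnTables (Φ : SNPFormula) (n : ℕ) (R : RelTables Φ.inputArities n) : Prop :=
  letI := structureOfTables R
  Φ.Holds (Fin n)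

/-- Unfolding `HoldsOnTables`: `Φ` holds on the tables `R` iff some Boolean witness tables `W`
make the joint structure on `Fin n` satisfy `Φ.sentence` (witness structures on `Fin n` are
exactly tables, `structureOfTables_tablesOfStructure`). [Impagliazzo–Paturi–Zane 2001, §3] [cite: ImpagliazzoPaturiZane2001, §3] -/
theorem holdsOnTables_iff (Φ : SNPFormula) (n : ℕ) (R : RelTables Φ.inputArities n) :
    Φ.HoldsOnTables n R ↔ ∃ W : RelTables Φ.witnessArities n,
      @FirstOrder.Language.Sentence.Realize _ (Fin n)
        (@FirstOrder.Language.sumStructure _ _ (Fin n) (structureOfTables R)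
          (structureOfTables W)) Φ.sentence := by
  refine ⟨?_, fun ⟨W, hW⟩ => ⟨structureOfTables W, hW⟩⟩
  rintro ⟨S, hS⟩
  refine ⟨tablesOfStructure S, ?_⟩
  rwa [structureOfTables_tablesOfStructure]

end SNPFormula

/-! ### Finite instances and their Boolean encoding -/

/-- A finite instance of an SNP problem with input arities `ar`: a universe size `n` together
with Boolean tables of the input relations on `Fin n`. [Impagliazzo–Paturi–Zane 2001, §3] [cite: ImpagliazzoPaturiZane2001, §3] -/
abbrev SNPInstance (ar : List ℕ) : Type :=
  Σ n : ℕ, RelTables ar n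

/-- The number of bits of the tables of relations of arities `ar` on a universe of size `n`:
`∑ᵢ n ^ (ar.get i)`. [Impagliazzo–Paturi–Zane 2001, §3] [cite: ImpagliazzoPaturiZane2001, §3] -/
def tableBits (ar : List ℕ) (n : ℕ) : ℕ :=
  ∑ i : Fin ar.length, n ^ ar.get i

/-- Boolean tables of arities `ar` on `Fin n` are bit vectors of length `tableBits ar n`: each
table `(Fin k → Fin n) → Bool` is a bit vector of length `n ^ k` via `finFunctionFinEquiv`, and
the tables are concatenated via `finSigmaFinEquiv`.
[Impagliazzo–Paturi–Zane 2001, §3 (an `n`-element structure with a `k`-ary relation takes `n^k`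
bits)] [cite: ImpagliazzoPaturiZane2001, §3 (an  n -element structure with a  k] -/
def relTablesEquiv (ar : List ℕ) (n : ℕ) : RelTables ar n ≃ (Fin (tableBits ar n) → Bool) :=
  (Equiv.piCongrRight fun i =>
      Equiv.arrowCongr (finFunctionFinEquiv (m := n) (n := ar.get i)) (Equiv.refl Bool)).trans <|
    (Equiv.piCurry fun (i : Fin ar.length) (_ : Fin (n ^ ar.get i)) => Bool).symm.trans <|
      Equiv.arrowCongr finSigmaFinEquiv (Equiv.refl Bool)

/-- Boolean tables of arities `ar` on `Fin n` over `Bool`: the bit vector `relTablesEquiv ar n R`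
written out with `encodingBitVec` (`List.ofFn`); decoding checks the length.
[Impagliazzo–Paturi–Zane 2001, §3] [cite: ImpagliazzoPaturiZane2001, §3] -/
def encodingRelTables (ar : List ℕ) (n : ℕ) : Encoding (RelTables ar n) Bool where
  encode R := (encodingBitVec (tableBits ar n)).encode (relTablesEquiv ar n R)
  decode w := ((encodingBitVec (tableBits ar n)).decode w).map (relTablesEquiv ar n).symm
  decode_encode R := by simp [(encodingBitVec (tableBits ar n)).decode_encode]

/-- Finite SNP instances over `Bool`: `⟨n, R⟩ ↦ boolPair (encodeNat n) (tables of R as bits)`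
(`Encoding.sigmaBool` over the universe size). [Impagliazzo–Paturi–Zane 2001, §3] [cite: ImpagliazzoPaturiZane2001, §3] -/
def encodingSNPInstance (ar : List ℕ) : Encoding (SNPInstance ar) Bool :=
  Encoding.sigmaBool (encodingRelTables ar)

/-- The encoding of `⟨n, R⟩` has length `Θ(log n) + tableBits ar n`: precisely
`(boolPair (encodeNat n) bits).length` with `bits.length = tableBits ar n`.
[Impagliazzo–Paturi–Zane 2001, §3] [cite: ImpagliazzoPaturiZane2001, §3] -/
theorem length_encodingSNPInstance_encode (ar : List ℕ) (x : SNPInstance ar) :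
    ((encodingSNPInstance ar).encode x).length =
      2 * (encodeNat x.1).length + 2 + tableBits ar x.1 := by
  simp [encodingSNPInstance, Encoding.sigmaBool, encodingRelTables, encodingBitVec,
    length_boolPair]

namespace SNPFormula

/-- The decision problem defined by an SNP formula `Φ`, as a language over `Bool`: encodings of
the finite instances `⟨n, R⟩` (input tables on `Fin n`) on which `Φ` holds.
[Papadimitriou–Yannakakis 1991, §2; Impagliazzo–Paturi–Zane 2001, §3] [cite: PapadimitriouYannakakis1991, §2] -/
def language (Φ : SNPFormula) : Language Bool :=
  (encodingSNPInstance Φ.inputArities).toLanguage {x | Φ.HoldsOnTables x.1 x.2}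

/-- The IPZ complexity parameter of `Φ` on a universe of size `n`: the number of bits needed to
write down the witness relations, `∑ᵢ n ^ (arity of Sᵢ)`.
[Impagliazzo–Paturi–Zane 2001, §3] [cite: ImpagliazzoPaturiZane2001, §3] -/
def witnessBits (Φ : SNPFormula) (n : ℕ) : ℕ :=
  ∑ i : Fin Φ.witnessArities.length, n ^ Φ.witnessArities.get i

/-- `witnessBits Φ n` is `tableBits Φ.witnessArities n` (definitional).
[Impagliazzo–Paturi–Zane 2001, §3] [cite: ImpagliazzoPaturiZane2001, §3] -/
theorem witnessBits_eq_tableBits (Φ : SNPFormula) (n : ℕ) :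
    Φ.witnessBits n = tableBits Φ.witnessArities n :=
  rfl

/-- The parameterised problem of an SNP formula: language `Φ.language`, and parameter
`witnessBits Φ n` on the codeword of an instance with universe `Fin n` (junk value `0` on
non-codewords, via `ParamProblem.ofEncoding`). Noncomputable (`ParamProblem.ofEncoding`).
[Impagliazzo–Paturi–Zane 2001, §3] [cite: ImpagliazzoPaturiZane2001, §3] -/
noncomputable def toParamProblem (Φ : SNPFormula) : ParamProblem :=
  ParamProblem.ofEncoding (encodingSNPInstance Φ.inputArities)
    {x | Φ.HoldsOnTables x.1 x.2} fun x => Φ.witnessBits x.1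

/-- The language of `Φ.toParamProblem` is `Φ.language` (definitional).
[Impagliazzo–Paturi–Zane 2001, §3] [cite: ImpagliazzoPaturiZane2001, §3] -/
@[simp] theorem toParamProblem_lang (Φ : SNPFormula) : Φ.toParamProblem.lang = Φ.language :=
  rfl

/-- On the codeword of an instance with universe `Fin n` the parameter of `Φ.toParamProblem` is
`witnessBits Φ n`. [Impagliazzo–Paturi–Zane 2001, §3] [cite: ImpagliazzoPaturiZane2001, §3] -/
@[simp] theorem toParamProblem_param_encode (Φ : SNPFormula) (x : SNPInstance Φ.inputArities) :
    Φ.toParamProblem.param ((encodingSNPInstance Φ.inputArities).encode x) =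
      Φ.witnessBits x.1 :=
  ParamProblem.ofEncoding_param_encode _ _ _ _

/-- Membership of a codeword in `Φ.language` is `HoldsOnTables`.
[Papadimitriou–Yannakakis 1991, §2] [cite: PapadimitriouYannakakis1991, §2] -/
@[simp] theorem encode_mem_language_iff (Φ : SNPFormula) (x : SNPInstance Φ.inputArities) :
    (encodingSNPInstance Φ.inputArities).encode x ∈ Φ.language ↔ Φ.HoldsOnTables x.1 x.2 :=
  Encoding.mem_toLanguage_iff _ _ _

/-- The witness parameter is monotone in the universe size. [Impagliazzo–Paturi–Zane 2001, §3] [cite: ImpagliazzoPaturiZane2001, §3] -/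
theorem witnessBits_mono (Φ : SNPFormula) : Monotone Φ.witnessBits := by
  intro m n h
  unfold witnessBits
  gcongr

end SNPFormula

/-! ### The classes -/

/-- The class `SNP` of parameterised problems defined by SNP formulas with the IPZ witness-size
parameter. [Impagliazzo–Paturi–Zane 2001, §3; Papadimitriou–Yannakakis 1991, §2] [cite: ImpagliazzoPaturiZane2001, §3] -/
def SNP : Set ParamProblem :=
  Set.range SNPFormula.toParamProblem

/-- The class of SNP-definable languages over `Bool` (forgetting the parameter).
[Papadimitriou–Yannakakis 1991, §2] [cite: PapadimitriouYannakakis1991, §2] -/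
def SNPLanguages : Set (Language Bool) :=
  Set.range SNPFormula.language

/-- `SNPLanguages` is the image of `SNP` under `ParamProblem.lang`.
[Impagliazzo–Paturi–Zane 2001, §3] [cite: ImpagliazzoPaturiZane2001, §3] -/
theorem SNPLanguages_eq_image : SNPLanguages = ParamProblem.lang '' SNP := by
  simp [SNPLanguages, SNP, ← Set.range_comp, Function.comp_def]

/-- Every SNP-definable language is in `NP`: guess the witness tables (`witnessBits Φ n ≤ |x|^c`
bits) and evaluate the universal first-order sentence by brute force over all `n^k` tuples
(the easy direction of Fagin's theorem). [Fagin 1974; Papadimitriou–Yannakakis 1991, §2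
("SNP ⊆ NP")] [cite: Fagin1974] -/
def SNPLanguages_subset_NP : Prop :=
  SNPLanguages ⊆ NP

end Literature.Computability.Cryptography
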